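import Summits.QuantumFields.YangMills.Theorems.IR.TensionRatioPlaquetteFloorTorusNumerator
import Summits.QuantumFields.YangMills.Theorems.IR.TorusWilsonLoopRepOddPlaquetteBound
import Literature.MathematicalPhysics.QuantumFieldTheory.WilsonEnergyConvexity
import HarnessLib

/-!
# Crux `IR` (stmt-QuantumFields-19354), line `tension-ratio`: the input `PlaquetteFloorSC` PROVED, and with it the
# registered rung T2-sc `RatioStrongCoupling` (and T2-sc-window) for EVERY centre-charged probe `π`

Pooled prover `ym-ir-line-pool-p3` (gen 3).  Helper module for item `stmt-QuantumFields-19354` (`--supports`; it closes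
nothing — `IR_of` does not consume the rungs).  Parts 1–4 (`TensionRatioPlaquetteFloor{Projection,Order,TorusPeel,
TorusExpansion}`) give, for every compact group `G`, every faithful continuous unitary `ρ` (the Wilson action's representation)
and every continuous matrix representation `π` of positive size, an order `k` and constants such that on EVERY torus
`(ℤ/L)⁴`, `L ≥ 2`, the numerator `∫ Re tr π(U_{p₀}) e^{−βS}` is `≥ ((β^k/k!)c − E β^{k+1}) ∫ e^{−βS_B}` with `c ≥ 2^{−k}` and
`∫ e^{−βS} ≤ ∫ e^{−βS_B}`; here (`wilsonExpectation_plaquette_rep_ge`) this becomes the **volume-uniform strong-coupling floor of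
the `π`-plaquette**: `∃ k w β_P > 0, ∀ L ≥ 2, ∀ β ∈ (0, β_P], ⟨W^π_{1×1}⟩_{Λ_L, β} ≥ w β^k`.  Consequences BY NAME:

* `plaquetteFloorSC_holds : PlaquetteFloorSC` (`TensionRatioDefs` §7; the line's ONE remaining typed input of rung T2-sc);
* `loopFloorSC_holds : LoopFloorSC`, `ratioStrongCoupling_holds : RatioStrongCoupling`,
  `ratioStrongCouplingWindow_holds : RatioStrongCouplingWindow` — via the landed reductions
  `loopFloorSC_of_plaquetteFloorSC` ∕ `ratioStrongCoupling_of_plaquetteFloorSC` ∕ `ratioStrongCouplingWindow_of_plaquetteFloorSC`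
  (`Theorems/IR/TorusWilsonLoopRepOddPlaquetteBound.lean`, p603904): the registered rung stubs `stub_rung_ratioStrongCoupling`
  and `stub_rung_ratioStrongCouplingWindow` of `Cruxes/IR/Lines/ym_ir7_tension_ratio.lean` now close by `exact`.

Method (new in the tree; no cluster expansion): split `e^{−βS} = e^{−βS_A} e^{−βS_B}` with `A` the `≤ 90` plaquettes touching
`p₀`; expand `e^{−βS_A}` to order `k`; every monomial covering a bond of `p₀` fewer than `k` times dies under the Haar integral
of that ONE bond (order `k` of the single-link integrals, part 2 — faithfulness of `ρ` via Stone–Weierstrass); the survivor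
`cost(p₀)^k` factorises through the group and carries the positive integer `tr P_t` of part 1; positivity of the costs makes
`∫ e^{−βS} ≤ ∫ e^{−βS_B}`, which is the whole volume-uniformity.  The centre charge of `π` is not used (it only forces `k ≥ 1`).

HONEST FRAMING: a FORMAT rung inside `IR`'s known strong-coupling regime (Osterwalder–Seiler 1978 §3; Montvay–Münster §3.4);
`TensionFloor` ∕ `RatioFloorSC` ∕ the residuals stay OPEN; nothing here proves confinement at weak coupling, a lattice gap in
units, `BalabanLadder.IR`, or the Yang–Mills mass gap (Clay); `R4` closes only the conditional finite-𝕋⁴ rung `BalabanLadder.UV`.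
-/

set_option autoImplicit false

noncomputable section

open MeasureTheory Finset Function Filter Topology
open Literature.MathematicalPhysics.QuantumFieldTheory Literature.MathematicalPhysics.QuantumLattice
open Summit.QuantumFields.YangMills.Cruxes.IR.SCFloor (mem_pedges)

namespace Summit.QuantumFields.YangMills.Cruxes.IR.TensionRatio.PlaquetteFloor

/-! ## §1 The volume-uniform floor of the `π`-plaquette -/

section Floor

variable {G : Type*} [Group G] [TopologicalSpace G] [IsTopologicalGroup G] [CompactSpace G]
  [MeasurableSpace G] [BorelSpace G] [SecondCountableTopology G] [T2Space G] {m N : ℕ}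
  (π : G →* Matrix (Fin m) (Fin m) ℂ) (ρ : G →* Matrix (Fin N) (Fin N) ℂ)

omit [TopologicalSpace G] [IsTopologicalGroup G] [CompactSpace G] [MeasurableSpace G] [BorelSpace G]
  [SecondCountableTopology G] [T2Space G] in
/-- The `1 × 1` Wilson loop of `π` at the origin of the `(0,1)` plane is `(1/m) Re tr π(U_{p₀})`. -/
theorem wilsonLoop_one_one_eq_plaquette {L : ℕ} (U : GaugeConfig 4 L G) :
    wilsonLoop π (0 : Site 4 L) 0 1 1 1 U = (m : ℝ)⁻¹ * (π (plaquetteHolonomy U 0 0 1)).trace.re := by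
  simp [wilsonLoop, rectangleHolonomy, lineHolonomy, plaquetteHolonomy, Site.shift]

/-- **The volume-uniform strong-coupling floor of the `π`-plaquette.**  For a compact group `G`, a faithful continuous
unitary `ρ` and a continuous `π` of positive size there are an order `k`, a constant `w > 0` and `β_P > 0` such that on EVERY
torus `(ℤ/L)⁴` with `L ≥ 2` and for every `β ∈ (0, β_P]`:  `w β^k ≤ ⟨W^π_{1×1}⟩_{Λ_L, β}`. -/
theorem wilsonExpectation_plaquette_rep_ge (hπ : Continuous π) (hm : 0 < m) (hρ : Continuous ρ)
    (hρi : Function.Injective ρ) (hρu : ∀ g, ρ g ∈ Matrix.unitaryGroup (Fin N) ℂ) :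
    ∃ (k : ℕ) (w βP : ℝ), 0 < w ∧ 0 < βP ∧ ∀ (L : ℕ) [NeZero L] [Fact (1 < L)] (β : ℝ), 0 < β → β ≤ βP →
      w * β ^ k ≤ wilsonExpectation (L := L) ρ β (wilsonLoop π (0 : Site 4 L) 0 1 1 1) := by
  classical
  obtain ⟨k, hV, hck⟩ := exists_order π ρ hπ hρ hρi hm
  set c : ℝ := ∫ h, (π h).trace.re * ((ρ h).trace.re) ^ k ∂haarProbability G with hc
  have hcpos : 0 < c := lt_of_lt_of_le (by positivity) hck
  obtain ⟨Cπ, hCπ⟩ : ∃ C : ℝ, ∀ h : G, |(π h).trace.re| ≤ C := by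
    obtain ⟨C, hC⟩ := isCompact_univ.exists_bound_of_continuousOn
      (Complex.continuous_re.comp hπ.matrix_trace).continuousOn
    exact ⟨C, fun h => Real.norm_eq_abs _ ▸ hC h (Set.mem_univ h)⟩
  have hCπ0 : 0 ≤ Cπ := le_trans (abs_nonneg _) (hCπ 1)
  -- volume-independent size of the touching set and of `S_A`
  set X : ℝ := (15 * Fintype.card {p : Fin 4 × Fin 4 // p.1 < p.2} : ℕ) * (2 * N) + 1 with hX
  have hX1 : 1 ≤ X := by
    have h0 : (0 : ℝ) ≤ (15 * Fintype.card {p : Fin 4 × Fin 4 // p.1 < p.2} : ℕ) * (2 * N) := by positivity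
    rw [hX]; linarith
  have hX0 : 0 < X := by linarith
  set E : ℝ := 2 * Cπ * X ^ (k + 1) with hE
  have hE0 : 0 ≤ E := by positivity
  -- the constants
  set βP : ℝ := min (1 / X) (c / ((k.factorial : ℝ) * 2 * (E + 1))) with hβP
  have hβP0 : 0 < βP := lt_min (by positivity) (by positivity)
  refine ⟨k, (m : ℝ)⁻¹ * (c / (2 * k.factorial)), βP, by positivity, hβP0, fun L _ _ β hβ hββP => ?_⟩
  -- the touching set
  set A : Finset (Plaquette 4 L) := Finset.univ.filter fun q : Plaquette 4 L =>
    ∃ e ∈ ({((0 : Site 4 L), (0 : Fin 4)), ((0 : Site 4 L).shift 0, (1 : Fin 4)), ((0 : Site 4 L).shift 1, (0 : Fin 4)),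
        ((0 : Site 4 L), (1 : Fin 4))} : Finset (Edge 4 L)),
      e ∈ ({(q.1, q.2.1.1), (q.1.shift q.2.1.1, q.2.1.2), (q.1.shift q.2.1.2, q.2.1.1), (q.1, q.2.1.2)} : Finset (Edge 4 L))
    with hA
  have hp₀ : ((0 : Site 4 L), ⟨((0 : Fin 4), (1 : Fin 4)), Fin.zero_lt_one⟩) ∈ A := by
    rw [hA, Finset.mem_filter]
    exact ⟨Finset.mem_univ _, ((0 : Site 4 L), (0 : Fin 4)), by simp, by simp⟩
  have hAblind : ∀ q ∉ A, ∀ e ∈ ({((0 : Site 4 L), (0 : Fin 4)), ((0 : Site 4 L).shift 0, (1 : Fin 4)),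
        ((0 : Site 4 L).shift 1, (0 : Fin 4)), ((0 : Site 4 L), (1 : Fin 4))} : Finset (Edge 4 L)),
      e ∉ ({(q.1, q.2.1.1), (q.1.shift q.2.1.1, q.2.1.2), (q.1.shift q.2.1.2, q.2.1.1), (q.1, q.2.1.2)} :
        Finset (Edge 4 L)) := by
    intro q hq e he heq
    exact hq (by rw [hA, Finset.mem_filter]; exact ⟨Finset.mem_univ _, e, he, heq⟩)
  have hcardA : (A.card : ℝ) * (2 * N) ≤ X := by
    have h := card_touching_le (L := L)
    rw [← hA] at h
    have : (A.card : ℝ) * (2 * N) ≤ (15 * Fintype.card {p : Fin 4 × Fin 4 // p.1 < p.2} : ℕ) * (2 * N) := by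
      exact_mod_cast Nat.mul_le_mul_right (2 * N) h
    linarith
  have hcardA0 : (0 : ℝ) ≤ A.card * (2 * N) := by positivity
  -- smallness of β
  have hβX : β * X ≤ 1 := by
    have : β ≤ 1 / X := hββP.trans (min_le_left _ _)
    rwa [le_div_iff₀ hX0] at this
  have hβA : β * (A.card * (2 * N)) ≤ 1 := le_trans (mul_le_mul_of_nonneg_left hcardA hβ.le) hβX
  -- the numerator bound and the partition-function comparison
  have hnum := integral_obs_mul_exp_ge π ρ hπ hρ hρu hV A hp₀ hAblind hCπ hβ.le hβA
  have hZle := integral_exp_le_integral_R (L := L) ρ hρ hρu A hβ.le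
  have hZpos : 0 < ∫ U, Real.exp (-β * wilsonAction ρ U) ∂(Measure.pi fun _ : Edge 4 L => haarProbability G) :=
    integral_exp_neg_mul_wilsonAction_pos ρ hρ β
  set Z := ∫ U, Real.exp (-β * wilsonAction ρ U) ∂(Measure.pi fun _ : Edge 4 L => haarProbability G) with hZ
  set ZB := ∫ U, Real.exp (-β * ∑ q ∈ Aᶜ, plaquetteCost ρ U q) ∂(Measure.pi fun _ : Edge 4 L => haarProbability G)
    with hZB
  -- the error term is at most half of the main term
  have herr : 2 * Cπ * (A.card * (2 * N)) ^ (k + 1) * β ^ (k + 1) ≤ β ^ k / (k.factorial : ℝ) * c / 2 := by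
    have h1 : 2 * Cπ * (A.card * (2 * N)) ^ (k + 1) ≤ E := by
      rw [hE]; exact mul_le_mul_of_nonneg_left (pow_le_pow_left₀ hcardA0 hcardA _) (by positivity)
    have h2 : β ≤ c / ((k.factorial : ℝ) * 2 * (E + 1)) := hββP.trans (min_le_right _ _)
    have h3 : β * ((k.factorial : ℝ) * 2 * (E + 1)) ≤ c := by rwa [le_div_iff₀ (by positivity)] at h2
    calc 2 * Cπ * (A.card * (2 * N)) ^ (k + 1) * β ^ (k + 1) ≤ E * β ^ (k + 1) :=
          mul_le_mul_of_nonneg_right h1 (by positivity)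
      _ = β ^ k * (E * β) := by ring
      _ ≤ β ^ k * (c / ((k.factorial : ℝ) * 2)) := by
          refine mul_le_mul_of_nonneg_left ?_ (by positivity)
          rw [le_div_iff₀ (by positivity)]
          nlinarith [hβ.le, hE0]
      _ = β ^ k / (k.factorial : ℝ) * c / 2 := by ring
  have hmain : β ^ k / (k.factorial : ℝ) * c / 2 * ZB ≤
      ∫ U, (π (plaquetteHolonomy U 0 0 1)).trace.re * Real.exp (-β * wilsonAction ρ U)
        ∂(Measure.pi fun _ : Edge 4 L => haarProbability G) := by
    refine le_trans ?_ hnum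
    refine mul_le_mul_of_nonneg_right ?_ (le_trans hZpos.le hZle)
    linarith
  -- divide by the partition function
  rw [wilsonExpectation_eq_integral_div ρ hρ β]
  simp_rw [wilsonLoop_one_one_eq_plaquette π]
  have hnumeq : ∫ U, (m : ℝ)⁻¹ * (π (plaquetteHolonomy U 0 0 1)).trace.re * Real.exp (-β * wilsonAction ρ U)
      ∂(Measure.pi fun _ : Edge 4 L => haarProbability G) =
      (m : ℝ)⁻¹ * ∫ U, (π (plaquetteHolonomy U 0 0 1)).trace.re * Real.exp (-β * wilsonAction ρ U)
        ∂(Measure.pi fun _ : Edge 4 L => haarProbability G) := by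
    rw [← integral_const_mul]
    refine integral_congr_ae (ae_of_all _ fun U => ?_)
    ring
  rw [hnumeq, le_div_iff₀ hZpos]
  have hm0 : (0 : ℝ) < (m : ℝ)⁻¹ := by positivity
  calc (m : ℝ)⁻¹ * (c / (2 * k.factorial)) * β ^ k * Z
      = (m : ℝ)⁻¹ * (β ^ k / (k.factorial : ℝ) * c / 2 * Z) := by ring
    _ ≤ (m : ℝ)⁻¹ * (β ^ k / (k.factorial : ℝ) * c / 2 * ZB) := by
        refine mul_le_mul_of_nonneg_left (mul_le_mul_of_nonneg_left hZle (by positivity)) hm0.le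
    _ ≤ (m : ℝ)⁻¹ * ∫ U, (π (plaquetteHolonomy U 0 0 1)).trace.re * Real.exp (-β * wilsonAction ρ U)
        ∂(Measure.pi fun _ : Edge 4 L => haarProbability G) := mul_le_mul_of_nonneg_left hmain hm0.le

end Floor

/-! ## §2 `PlaquetteFloorSC` and the rung T2-sc, BY NAME -/

/-- **Input (b2) of rung T2-sc PROVED**: the strong-coupling `π`-plaquette floor on odd tori, for every compact `G` (simplicity
and simple connectivity unused), every lattice representation `r` and every continuous `π` of positive size (the centre charge is
unused). -/
theorem plaquetteFloorSC_holds : PlaquetteFloorSC := by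
  intro G _ _ _ _ _hG _hsc
  letI : MeasurableSpace G := borel G
  haveI : BorelSpace G := ⟨rfl⟩
  intro r Nπ π z ω hNπ hπ _hz _hω _hπz
  haveI : SecondCountableTopology G :=
    (r.continuous.isClosedEmbedding r.injective).isEmbedding.secondCountableTopology
  haveI : T2Space G := (r.continuous.isClosedEmbedding r.injective).isEmbedding.t2Space
  obtain ⟨k, w, βP, hw, hβP, hmain⟩ :=
    wilsonExpectation_plaquette_rep_ge π r.ρ hπ hNπ r.continuous r.injective r.mem_unitary
  refine ⟨βP, hβP, k, w, hw, fun β hβ hββP => ⟨1, fun S _ => ?_⟩⟩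
  rw [torusRect_eq_wilsonExpectation]
  haveI : Fact (1 < 2 * S + 1) := ⟨by omega⟩
  exact hmain (2 * S + 1) β hβ hββP

/-- **Input (b) of rung T2-sc PROVED**: the strong-coupling loop floor on odd tori (`LoopFloorSC`), by the landed odd-torus
reflection-positivity chain `loopFloorSC_of_plaquetteFloorSC`. -/
theorem loopFloorSC_holds : LoopFloorSC :=
  loopFloorSC_of_plaquetteFloorSC plaquetteFloorSC_holds

/-- **RUNG T2-sc PROVED for every centre-charged `π`**: `RatioStrongCoupling` (the registered rung stub
`stub_rung_ratioStrongCoupling` of line `ym-ir7-tension-ratio` closes by `exact ratioStrongCoupling_holds`).  Inputs: (a) the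
rate-tracking strong-coupling cold pressure bound p600923, (b) this floor, composed by `ratioStrongCoupling_of_plaquetteFloorSC`
p603904.  A FORMAT rung inside `IR`'s known regime — not a witness of weakness; the YM mass gap is NOT proved. -/
theorem ratioStrongCoupling_holds : RatioStrongCoupling :=
  ratioStrongCoupling_of_plaquetteFloorSC plaquetteFloorSC_holds

/-- **RUNG T2-sc-window PROVED for every centre-charged `π`** (`stub_rung_ratioStrongCouplingWindow` closes by `exact`). -/
theorem ratioStrongCouplingWindow_holds : RatioStrongCouplingWindow :=
  ratioStrongCouplingWindow_of_plaquetteFloorSC plaquetteFloorSC_holds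

end Summit.QuantumFields.YangMills.Cruxes.IR.TensionRatio.PlaquetteFloor

end
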